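import Literature.AlgebraicGeometry.Motives.ComplexTorusHomEquivalence
import HarnessLib

/-!
# The homomorphism of abelian varieties of a `ℂ`-linear, lattice-compatible map between uniformising tori
# (Lange–Birkenhake Prop. 1.2.1 / Lange 2023 Prop. 1.1.6 with Cor. 2.1.17; Shimura 1998 §7.4 Prop. 15)

Topic `Literature/AlgebraicGeometry/Motives`; namespaces `Literature.Geometry.Kaehler.ComplexTorus` (§1–§2, tori only)
and `Literature.AlgebraicGeometry.Motives.AbelianVariety` (§3).  THEOREMS ONLY (no definition, no named fact, no instance,
no `sorry`; net Literature debt 0).  Cell `hodgecm-mathlib` (D-0151), #60 road / Mumford line, M3a (CENSUS-M3a §5, piece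
M3a-α «torus maps of a marking»): the consumer-facing form of ★ `ComplexTorusHomEquivalence` (`homInt`, `homOfMatrix`,
`map_homOfMatrix`) in which the input is a `ℂ`-LINEAR MAP `T : E → E′` between the universal covers carrying the lattice
into the lattice — the shape in which the CM projections `B → Aᵢ` and the maps `Aᵢ^σ → B′` of the reciprocity step arise
(`T = prᵢ ∘ e ∘ γ ∘ Ψ⁻¹`, `T′ = Ψ′ ∘ γ′⁻¹ ∘ e⁻¹ ∘ inclᵢ ∘ M`) — rather than an integer matrix already known to be in
`Hom(X, X′)`.

## What is proved (tori `X = E/Φ(ℤ^ι)`, `X′ = E′/Φ′(ℤ^ι′)`; `T : E →L[ℂ] E′` with `T(Φ eₖ) ∈ Φ′(ℤ^ι′)` for every `k`)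

* §1 `ComplexTorus.exists_mem_homInt_analyticRep_eq` — there is an integer matrix `M ∈ Hom(X, X′)` (★ `homInt Φ Φ′`) whose
  analytic representation is `T`: `Φ′(M · x) = T(Φ x)` for all `x ∈ ℝ^ι` (★ `exists_eq_realRep_of_apply_basis` applied to `T|_ℝ`
  — the columns of `M` are the lattice coordinates of the `T(Φ eₖ)` — and `M ∈ homInt` by ★ `mem_homInt_iff_exists_analyticRep`).
* §2 `ComplexTorus.mapMatrix_cover_eq_cover` — for such `M`, the torus homomorphism `mapMatrix Φ Φ′ M` IS «`z ↦ T z`»: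
  `mapMatrix M (cover Φ z) = cover Φ′ (T z)` for every `z ∈ E` (★ `mapMatrix_cover` + ★ `analyticRep_restrictScalars`).
* §3 `AbelianVariety.exists_hom_map_cover_eq` — for complex abelian varieties `A`, `A′` analytified by `X`, `X′` over the
  origins (`φ`, `φ′`, with `φ 0 = 1`, `φ′ 0 = 1`), THERE IS `u : A ⟶ A′` with **`u(ℂ)(φ(cover Φ z)) = φ′(cover Φ′ (T z))`**
  for all `z ∈ E` (★ `homOfMatrix` + §1–§2); `AbelianVariety.hom_eq_of_map_cover_eq` — such a `u` is unique (★
  `hom_unique_of_isAnalytification`, `cover` surjective).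

Lange–Birkenhake Prop. 1.2.1: «a homomorphism `f : X → X′` is induced by a unique `ℂ`-linear map `F : V → V′` with
`F(Λ) ⊂ Λ′`» — here the converse packaging «every such `F` induces a homomorphism», made algebraic by Cor. 2.1.17 /
Mumford §1 (3) (the tree's GAGA-for-maps + rigidity inside ★ `homOfMatrix`).

## References
* [LangeBirkenhake1992] H. Lange, Ch. Birkenhake, *Complex Abelian Varieties* (1992), Ch. 1 §1.2 Prop. 1.2.1; Ch. 2 Cor. 2.1.17.
* [Lange2023AbelianVarietiesComplex] H. Lange, *Abelian Varieties over the Complex Numbers* (2023), §1.1.2 Prop. 1.1.6; §2.1.4 Cor. 2.1.17.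
* [Shimura1998] G. Shimura, *Abelian Varieties with Complex Multiplication and Modular Functions* (1998), §7.4 Prop. 15 p. 58
  («`S(γ)` represents a homomorphism»).
* [MumfordAV1970] D. Mumford, *Abelian Varieties* (1970), §1 (3).
-/

noncomputable section

open scoped Manifold ContDiff
open CategoryTheory AlgebraicGeometry Matrix

/-! ### §1–§2 Tori: the integer matrix of a `ℂ`-linear lattice-compatible map, and what it does on the cover -/

namespace Literature.Geometry.Kaehler

namespace ComplexTorus

variable {ι ι' : Type*} [Fintype ι] [Fintype ι'] [DecidableEq ι] [DecidableEq ι']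
  {E E' : Type*} [NormedAddCommGroup E] [NormedSpace ℂ E] [NormedAddCommGroup E'] [NormedSpace ℂ E']
  (Φ : (ι → ℝ) ≃L[ℝ] E) (Φ' : (ι' → ℝ) ≃L[ℝ] E')

/-- **The rational representation of a `ℂ`-linear lattice-compatible map.**  If `T : E → E′` is `ℂ`-linear and carries
every basis vector `Φ eₖ` of the lattice `Φ(ℤ^ι)` into the lattice `Φ′(ℤ^ι′)`, then there is an integer matrix
`M ∈ Hom(X, X′)` (★ `homInt Φ Φ′`: holomorphic `mapMatrix`) with analytic representation `T`: `Φ′(M · x) = T(Φ x)` for all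
`x ∈ ℝ^ι` (Lange 2023 Prop. 1.1.6: `ρ_r(f) = F|_Λ`). [cite: Lange2023AbelianVarietiesComplex, §1.1.2 Prop. 1.1.6]
[cite: LangeBirkenhake1992, Ch. 1 §1.2 Prop. 1.2.1] -/
theorem exists_mem_homInt_analyticRep_eq (T : E →L[ℂ] E')
    (hT : ∀ k : ι, ∃ z : ι' → ℤ, T (Φ (Pi.single k 1)) = latticeVec Φ' z) :
    ∃ M : Matrix ι' ι ℤ, M ∈ homInt Φ Φ' ∧ ∀ x : ι → ℝ, Φ' ((M.map (Int.cast : ℤ → ℝ)) *ᵥ x) = T (Φ x) := by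
  -- ★ `exists_eq_realRep_of_apply_basis`: `T|_ℝ = Φ′ ∘ M_ℝ ∘ Φ⁻¹` for an integer matrix `M`
  obtain ⟨M, hM⟩ := exists_eq_realRep_of_apply_basis (Φ := Φ) (Φ' := Φ') (G := T.restrictScalars ℝ) hT
  have hrep : ∀ x : ι → ℝ, Φ' ((M.map (Int.cast : ℤ → ℝ)) *ᵥ x) = T (Φ x) := fun x => by
    have h := congrArg (fun G : E →L[ℝ] E' => G (Φ x)) hM
    simp only [ContinuousLinearMap.coe_restrictScalars', realRep_apply] at h
    exact h.symm
  exact ⟨M, (mem_homInt_iff_exists_analyticRep Φ Φ').2 ⟨T, hrep⟩, hrep⟩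

omit [Fintype ι'] [DecidableEq ι] [DecidableEq ι'] in
/-- **On the universal covers, `mapMatrix M` is `T`**: if `Φ′(M · x) = T(Φ x)` for all `x`, then
`mapMatrix Φ Φ′ M (cover Φ z) = cover Φ′ (T z)` for every `z ∈ E` (★ `mapMatrix_cover` with ★ `analyticRep_restrictScalars`:
the real lift of `mapMatrix M` is `T|_ℝ`). [cite: Lange2023AbelianVarietiesComplex, §1.1.2 Prop. 1.1.6] [cite: LangeBirkenhake1992, Ch. 1 §1.2 Prop. 1.2.1] -/
theorem mapMatrix_cover_eq_cover {M : Matrix ι' ι ℤ} {T : E →L[ℂ] E'}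
    (hM : ∀ x : ι → ℝ, Φ' ((M.map (Int.cast : ℤ → ℝ)) *ᵥ x) = T (Φ x)) (z : E) :
    mapMatrix Φ Φ' M (cover Φ z) = cover Φ' (T z) := by
  rw [mapMatrix_cover, ← analyticRep_restrictScalars hM, ContinuousLinearMap.coe_restrictScalars']

end ComplexTorus

end Literature.Geometry.Kaehler

/-! ### §3 Abelian varieties: the homomorphism induced by `T` -/

namespace Literature.AlgebraicGeometry.Motives

open Literature.NumberTheory.Transcendental Literature.Geometry.Kaehler

namespace AbelianVariety

variable {ι : Type} [Fintype ι] [DecidableEq ι] {E : Type} [NormedAddCommGroup E] [NormedSpace ℂ E]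
  [FiniteDimensional ℂ E] {Φ : (ι → ℝ) ≃L[ℝ] E}
  {ι' : Type} [Fintype ι'] [DecidableEq ι'] {E' : Type} [NormedAddCommGroup E'] [NormedSpace ℂ E']
  [FiniteDimensional ℂ E'] {Φ' : (ι' → ℝ) ≃L[ℝ] E'}
  {A A' : AbelianVariety ℂ}
  {φ : ComplexTorus Φ → ComplexPoints A.X} {φ' : ComplexTorus Φ' → ComplexPoints A'.X}

/-- **A `ℂ`-linear map of the covers carrying lattice into lattice induces a homomorphism of the abelian varieties.**
For complex abelian varieties `A`, `A′` analytified by the tori `X = E/Φ(ℤ^ι)`, `X′ = E′/Φ′(ℤ^ι′)` over the origins and a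
`ℂ`-linear `T : E → E′` with `T(Φ eₖ) ∈ Φ′(ℤ^ι′)` for all `k`, there is `u : A ⟶ A′` with `u(ℂ)(φ(π z)) = φ′(π′(T z))` for
every `z ∈ E` — Lange–Birkenhake Prop. 1.2.1 («`F : V → V′` with `F(Λ) ⊂ Λ′` induces a homomorphism») made algebraic by
Cor. 2.1.17 / Mumford §1 (3) (★ `homOfMatrix`).  Shimura's «`S(γ)` represents a homomorphism» is the case `T = S(γ)`.
[cite: LangeBirkenhake1992, Ch. 1 §1.2 Prop. 1.2.1; Ch. 2 Cor. 2.1.17] [cite: Lange2023AbelianVarietiesComplex, §2.1.4 Cor. 2.1.17]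
[cite: Shimura1998, §7.4 Prop. 15, p. 58] [cite: MumfordAV1970, §1 (3)] -/
theorem exists_hom_map_cover_eq (hφ : IsAnalytification E A.X A.dim φ)
    (hφ' : IsAnalytification E' A'.X A'.dim φ') (hφ0 : φ 0 = 1) (hφ'0 : φ' 0 = 1) (T : E →L[ℂ] E')
    (hT : ∀ k : ι, ∃ z : ι' → ℤ, T (Φ (Pi.single k 1)) = ComplexTorus.latticeVec Φ' z) :
    ∃ u : A ⟶ A', ∀ z : E,
      AlgPoints.map u.hom.hom.hom (φ (ComplexTorus.cover Φ z)) = φ' (ComplexTorus.cover Φ' (T z)) := by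
  obtain ⟨M, hM, hMT⟩ := ComplexTorus.exists_mem_homInt_analyticRep_eq Φ Φ' T hT
  refine ⟨homOfMatrix hφ hφ' hφ0 hφ'0 M hM, fun z => ?_⟩
  rw [map_homOfMatrix, ComplexTorus.mapMatrix_cover_eq_cover Φ Φ' hMT]

omit [DecidableEq ι] [Fintype ι'] [DecidableEq ι'] [FiniteDimensional ℂ E'] in
/-- **Uniqueness**: two homomorphisms `u, v : A ⟶ A′` both inducing `z ↦ T z` on the covers are equal (homomorphisms agreeing
on `ℂ`-points are equal; `π` is onto). [cite: MumfordAV1970, §4] [cite: LangeBirkenhake1992, Ch. 1 §1.2 Prop. 1.2.1 (uniqueness of F)] -/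
theorem hom_eq_of_map_cover_eq (hφ : IsAnalytification E A.X A.dim φ) (T : E →L[ℂ] E') {u v : A ⟶ A'}
    (hu : ∀ z : E, AlgPoints.map u.hom.hom.hom (φ (ComplexTorus.cover Φ z)) = φ' (ComplexTorus.cover Φ' (T z)))
    (hv : ∀ z : E, AlgPoints.map v.hom.hom.hom (φ (ComplexTorus.cover Φ z)) = φ' (ComplexTorus.cover Φ' (T z))) :
    u = v := by
  refine hom_unique_of_isAnalytification hφ (φ' := φ')
    (f := fun t => ComplexTorus.cover Φ' (T (Φ (ComplexTorus.lift Φ t)))) (fun t => ?_) (fun t => ?_)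
  · conv_rhs => rw [← ComplexTorus.proj_lift Φ t, ← ComplexTorus.cover_apply_apply]
    exact (hu _).symm
  · conv_rhs => rw [← ComplexTorus.proj_lift Φ t, ← ComplexTorus.cover_apply_apply]
    exact (hv _).symm

end AbelianVariety

end Literature.AlgebraicGeometry.Motives

end
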